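import Literature.Analysis.FluidPDE.SolenoidalTruncation
import Literature.Analysis.FluidPDE.PineauVicolSliceEnstrophy
import HarnessLib

/-!
# Crux `ExtremiserTransience.NearExtremalTransience` (stmt-NavierStokesRegularity-21883), line `extremiser_liouville`,
# stub K1b — DENSITY LEAF, part 3a: THE PROFILE FORM OF THE SOLENOIDAL TRUNCATION AND LEIBNIZ BOUNDS

`--supports stmt-NavierStokesRegularity-21883` (helper).  Author: prover seat `ns-el-k1b` (g2).

For the tree's explicit divergence-free truncation `Ψ_R = solenoidalTruncation V R`
(`Literature/Analysis/FluidPDE/SolenoidalTruncation.lean`; `Ψ_R = χ_R V + Dχ_R(x) F − Dχ_R(F) x`, `F = poincareField V`)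
this file proves the pointwise bounds of the error `Ψ_R − V` and of its first and SECOND derivatives that the
palinstrophy estimate of the density leaf needs, in the scale-invariant form with annulus indicators:

* `solenoidalTruncation_eq_profile` — `Ψ_R(x) = χ(x/R) V(x) + Φ(x/R)[F(x)]` with the FIXED smooth compactly supported
  profiles `χ = dyadicCutoff` and `Φ(y) = (Dχ(y)y)·id − Dχ(y) ⊗ y`;
* `norm_iteratedFDeriv_scaledProfile_apply_le_one/_two` — Leibniz bounds for `x ↦ Φ(x/R)[g(x)]`:
  `‖D¹‖ ≤ a₀‖Dg‖ + (a₁/R)‖g‖`, `‖D²‖ ≤ a₀‖D²g‖ + (2a₁/R)‖Dg‖ + (a₂/R²)‖g‖` (Mathlib's `norm_iteratedFDeriv_clm_apply`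
  and `ContinuousLinearMap.iteratedFDeriv_comp_right`);
* `fderiv_fderiv_poincareField`, `enorm_iteratedFDeriv_two_poincareField_le` — `D²F(x) = ∫₀¹ t³ D²V(tx) dt`, hence
  `‖D²F(x)‖ ≤ ∫₀¹ t³ ‖D²V(tx)‖ dt` (differentiation under the integral sign, as the tree's `fderiv_poincareField`);
The error bounds themselves (`exists_truncation_error_bounds`) are in the companion file `…TruncationBounds`.

WHAT THIS IS NOT: nothing here is about Navier–Stokes solutions; the crux NET, rung N0 and NS regularity stay
OPEN — nothing here proves NS regularity. [folklore]
-/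

noncomputable section

open Set Filter Topology MeasureTheory Metric Function
open scoped ENNReal NNReal Topology
open Literature.Analysis.FluidPDE Literature.Analysis

namespace Summit.NavierStokesRegularity.NavierStokesRegularity.Theorems

-- the problem directory repeats the summit name (`NavierStokesRegularity/NavierStokesRegularity`)
set_option linter.dupNamespace false

namespace ExtremiserLiouville

/-! ## Small calculus helpers -/

/-- Iterated derivatives only depend on the germ. [folklore] -/
theorem iteratedFDeriv_eq_of_eventuallyEq {G : Type*} [NormedAddCommGroup G] [NormedSpace ℝ G]
    {f g : EuclideanSpace ℝ (Fin 3) → G} {x : EuclideanSpace ℝ (Fin 3)} (h : f =ᶠ[𝓝 x] g) (n : ℕ) :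
    iteratedFDeriv ℝ n f x = iteratedFDeriv ℝ n g x := by
  rw [← iteratedFDerivWithin_univ, ← iteratedFDerivWithin_univ]
  have h' : f =ᶠ[𝓝[univ] x] g := by rwa [nhdsWithin_univ]
  exact h'.iteratedFDerivWithin_eq h.eq_of_nhds n

/-! ## The second derivative of the Poincaré field -/

section PoincareTwo

variable {V : EuclideanSpace ℝ (Fin 3) → EuclideanSpace ℝ (Fin 3)}

/-- The partial derivative in `x` of `t² W(t x)` is `t³ DW(t x)` (`W` a `C¹` field of linear maps). [folklore] -/
theorem hasFDerivAt_sq_smul_comp_smul {W : EuclideanSpace ℝ (Fin 3) → (EuclideanSpace ℝ (Fin 3) →L[ℝ] EuclideanSpace ℝ (Fin 3))}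
    (hW : ContDiff ℝ 1 W) (t : ℝ) (x : EuclideanSpace ℝ (Fin 3)) :
    HasFDerivAt (fun y : EuclideanSpace ℝ (Fin 3) => (t ^ 2) • W (t • y)) ((t ^ 3) • fderiv ℝ W (t • x)) x := by
  have h1 : HasFDerivAt (fun y : EuclideanSpace ℝ (Fin 3) => t • y) (t • ContinuousLinearMap.id ℝ _) x :=
    (hasFDerivAt_id x).const_smul t
  have h2 : HasFDerivAt W (fderiv ℝ W (t • x)) (t • x) := (hW.differentiable one_ne_zero _).hasFDerivAt
  have h3 : HasFDerivAt (fun y : EuclideanSpace ℝ (Fin 3) => (t ^ 2) • W (t • y))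
      ((t ^ 2) • (fderiv ℝ W (t • x)).comp (t • ContinuousLinearMap.id ℝ _)) x :=
    (h2.comp x h1).const_smul (t ^ 2)
  convert h3 using 1
  ext v
  simp [pow_succ, smul_smul, mul_assoc]

/-- **Second derivative of the Poincaré field**: `D(DF)(x) = ∫₀¹ t³ D²V(t x) dt` for `C²` fields (differentiate
`DF(x) = ∫₀¹ t² DV(tx) dt`, the tree's `fderiv_poincareField`, once more under the integral sign). [folklore] -/
theorem fderiv_fderiv_poincareField (hV : ContDiff ℝ 2 V) (x : EuclideanSpace ℝ (Fin 3)) :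
    fderiv ℝ (fderiv ℝ (poincareField V)) x = ∫ t in (0 : ℝ)..1, (t ^ 3) • fderiv ℝ (fderiv ℝ V) (t • x) := by
  have hV1 : ContDiff ℝ 1 V := hV.of_le (by norm_num)
  have hW : ContDiff ℝ 1 (fderiv ℝ V) := hV.fderiv_right (m := 1) (by norm_num)
  have hDF : fderiv ℝ (poincareField V) = fun x => ∫ t in (0 : ℝ)..1, (t ^ 2) • fderiv ℝ V (t • x) :=
    funext fun x => fderiv_poincareField hV1 x
  rw [hDF]
  -- differentiate under the integral sign
  have hj : ContDiff ℝ 1 (uncurry fun (y : EuclideanSpace ℝ (Fin 3)) (t : ℝ) => (t ^ 2) • fderiv ℝ V (t • y)) := by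
    have : ContDiff ℝ 1 fun p : EuclideanSpace ℝ (Fin 3) × ℝ => (p.2 ^ 2) • fderiv ℝ V (p.2 • p.1) :=
      (contDiff_snd.pow 2).smul (hW.comp (contDiff_snd.smul contDiff_fst))
    exact this
  have h := hasFDerivAt_intervalIntegral_of_contDiff hj 0 1 x
  have heq : ∀ t : ℝ, (fderiv ℝ (uncurry fun (y : EuclideanSpace ℝ (Fin 3)) (t : ℝ) => (t ^ 2) • fderiv ℝ V (t • y)) (x, t)).comp
      (ContinuousLinearMap.inl ℝ (EuclideanSpace ℝ (Fin 3)) ℝ) = (t ^ 3) • fderiv ℝ (fderiv ℝ V) (t • x) := fun t =>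
    (hasFDerivAt_param_of_contDiff hj x t).unique (hasFDerivAt_sq_smul_comp_smul hW t x)
  simp_rw [heq] at h
  exact h.fderiv

/-- `‖D²F(x)‖ ≤ ∫₀¹ t³ ‖D²V(tx)‖ dt` (extended form, `D²V` as `D(DV)`). [folklore] -/
theorem enorm_iteratedFDeriv_two_poincareField_le (hV : ContDiff ℝ 2 V) (x : EuclideanSpace ℝ (Fin 3)) :
    ‖iteratedFDeriv ℝ 2 (poincareField V) x‖ₑ ≤
      ∫⁻ t in Ioo (0 : ℝ) 1, ENNReal.ofReal (t ^ 3) * ‖fderiv ℝ (fderiv ℝ V) (t • x)‖ₑ := by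
  have hconv : ‖iteratedFDeriv ℝ 2 (poincareField V) x‖ₑ = ‖fderiv ℝ (fderiv ℝ (poincareField V)) x‖ₑ :=
    calc ‖iteratedFDeriv ℝ 2 (poincareField V) x‖ₑ = ENNReal.ofReal ‖iteratedFDeriv ℝ 2 (poincareField V) x‖ :=
          (ofReal_norm _).symm
      _ = ENNReal.ofReal ‖fderiv ℝ (fderiv ℝ (poincareField V)) x‖ := by rw [norm_iteratedFDeriv_two_eq_norm_fderiv_fderiv_fin3]
      _ = ‖fderiv ℝ (fderiv ℝ (poincareField V)) x‖ₑ := by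
          exact ofReal_norm (fderiv ℝ (fderiv ℝ (poincareField V)) x)
  rw [hconv, fderiv_fderiv_poincareField hV x, intervalIntegral.integral_of_le zero_le_one,
    ← restrict_Ioo_eq_restrict_Ioc]
  refine (enorm_integral_le_lintegral_enorm _).trans (setLIntegral_mono' measurableSet_Ioo fun t ht => ?_)
  set A : EuclideanSpace ℝ (Fin 3) →L[ℝ] (EuclideanSpace ℝ (Fin 3) →L[ℝ] EuclideanSpace ℝ (Fin 3)) :=
    fderiv ℝ (fderiv ℝ V) (t • x) with hA
  have ht3 : 0 ≤ t ^ 3 := pow_nonneg ht.1.le 3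
  -- `‖t³ • A‖ ≤ t³ ‖A‖` through the operator norm (the scalar action on nested operator spaces)
  have key : ‖(t ^ 3) • A‖ ≤ t ^ 3 * ‖A‖ := by
    refine ContinuousLinearMap.opNorm_le_bound _ (by positivity) fun v => ?_
    change ‖(t ^ 3) • (A v)‖ ≤ _
    rw [norm_smul, Real.norm_of_nonneg ht3, mul_assoc]
    gcongr
    exact A.le_opNorm v
  calc ‖(t ^ 3) • A‖ₑ = ENNReal.ofReal ‖(t ^ 3) • A‖ := by exact (ofReal_norm ((t ^ 3) • A)).symm
    _ ≤ ENNReal.ofReal (t ^ 3 * ‖A‖) := ENNReal.ofReal_le_ofReal key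
    _ = ENNReal.ofReal (t ^ 3) * ‖A‖ₑ := by
        rw [ENNReal.ofReal_mul ht3]
        congr 1
        exact ofReal_norm A

end PoincareTwo

/-! ## Leibniz bounds for scaled profiles `x ↦ Φ(x/R)[g(x)]` -/

section Profile

variable {G : Type*} [NormedAddCommGroup G] [NormedSpace ℝ G]

/-- Scaling of iterated derivatives: `‖Dⁱ(Φ(·/R))(x)‖ ≤ R⁻ⁱ ‖DⁱΦ(x/R)‖` for `R > 0`. [folklore] -/
theorem norm_iteratedFDeriv_comp_smul_le {H : Type*} [NormedAddCommGroup H] [NormedSpace ℝ H]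
    {Φ : EuclideanSpace ℝ (Fin 3) → H} {n : ℕ} (hΦ : ContDiff ℝ n Φ) {R : ℝ} (hR : 0 < R) {i : ℕ} (hi : i ≤ n)
    (x : EuclideanSpace ℝ (Fin 3)) :
    ‖iteratedFDeriv ℝ i (fun x => Φ (R⁻¹ • x)) x‖ ≤ (R⁻¹) ^ i * ‖iteratedFDeriv ℝ i Φ (R⁻¹ • x)‖ := by
  set L : EuclideanSpace ℝ (Fin 3) →L[ℝ] EuclideanSpace ℝ (Fin 3) := R⁻¹ • ContinuousLinearMap.id ℝ _ with hL
  have hfun : (fun x => Φ (R⁻¹ • x)) = Φ ∘ L := by funext x; simp [hL]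
  have hLn : ‖L‖ ≤ R⁻¹ := by
    rw [hL, norm_smul, Real.norm_of_nonneg (inv_nonneg.2 hR.le)]
    calc R⁻¹ * ‖ContinuousLinearMap.id ℝ (EuclideanSpace ℝ (Fin 3))‖ ≤ R⁻¹ * 1 := by
          gcongr; exact ContinuousLinearMap.norm_id_le
      _ = R⁻¹ := mul_one _
  rw [hfun, ContinuousLinearMap.iteratedFDeriv_comp_right L hΦ x (by exact_mod_cast hi)]
  refine (ContinuousMultilinearMap.norm_compContinuousLinearMap_le _ _).trans ?_
  rw [Finset.prod_const, Finset.card_univ, Fintype.card_fin, mul_comm]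
  have hLx : L x = R⁻¹ • x := by simp [hL]
  rw [hLx]
  gcongr

/-- **First-order Leibniz bound for a scaled profile.**  If `Φ : ℝ³ → (ℝ³ →L G)` is `C¹` with `‖Φ‖ ≤ a₀`,
`‖DΦ‖ ≤ a₁`, and `g` is `C¹`, then for `R > 0`:
`‖D(Φ(·/R)[g])(x)‖ ≤ a₀ ‖Dg(x)‖ + (a₁/R) ‖g(x)‖`. [folklore] -/
theorem norm_iteratedFDeriv_scaledProfile_apply_le_one
    {Φ : EuclideanSpace ℝ (Fin 3) → (EuclideanSpace ℝ (Fin 3) →L[ℝ] G)} (hΦ : ContDiff ℝ 1 Φ) {a₀ a₁ : ℝ}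
    (h0 : ∀ y, ‖Φ y‖ ≤ a₀) (h1 : ∀ y, ‖iteratedFDeriv ℝ 1 Φ y‖ ≤ a₁)
    {g : EuclideanSpace ℝ (Fin 3) → EuclideanSpace ℝ (Fin 3)} (hg : ContDiff ℝ 1 g) {R : ℝ} (hR : 0 < R)
    (x : EuclideanSpace ℝ (Fin 3)) :
    ‖iteratedFDeriv ℝ 1 (fun x => Φ (R⁻¹ • x) (g x)) x‖ ≤
      a₀ * ‖iteratedFDeriv ℝ 1 g x‖ + a₁ / R * ‖g x‖ := by
  have hΦR : ContDiff ℝ 1 (fun x : EuclideanSpace ℝ (Fin 3) => Φ (R⁻¹ • x)) := hΦ.comp (contDiff_const_smul _)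
  have h := norm_iteratedFDeriv_clm_apply (n := 1) hΦR hg x (by norm_num)
  have h' : ‖iteratedFDeriv ℝ 1 (fun x => Φ (R⁻¹ • x) (g x)) x‖ ≤
      ‖iteratedFDeriv ℝ 0 (fun x : EuclideanSpace ℝ (Fin 3) => Φ (R⁻¹ • x)) x‖ * ‖iteratedFDeriv ℝ 1 g x‖ +
        ‖iteratedFDeriv ℝ 1 (fun x : EuclideanSpace ℝ (Fin 3) => Φ (R⁻¹ • x)) x‖ * ‖iteratedFDeriv ℝ 0 g x‖ := by
    simp only [Finset.sum_range_succ, Finset.sum_range_zero, zero_add, Nat.choose_zero_right, Nat.cast_one,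
      one_mul, Nat.choose_self, Nat.sub_zero] at h
    exact h
  refine h'.trans ?_
  rw [norm_iteratedFDeriv_zero, norm_iteratedFDeriv_zero]
  have e0 : ‖Φ (R⁻¹ • x)‖ ≤ a₀ := h0 _
  have e1 : ‖iteratedFDeriv ℝ 1 (fun x : EuclideanSpace ℝ (Fin 3) => Φ (R⁻¹ • x)) x‖ ≤ a₁ / R := by
    refine (norm_iteratedFDeriv_comp_smul_le hΦ hR le_rfl x).trans ?_
    rw [pow_one, div_eq_inv_mul]
    gcongr
    exact h1 _
  have ha₀ : 0 ≤ a₀ := (norm_nonneg _).trans (h0 0)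
  calc ‖Φ (R⁻¹ • x)‖ * ‖iteratedFDeriv ℝ 1 g x‖ +
        ‖iteratedFDeriv ℝ 1 (fun x : EuclideanSpace ℝ (Fin 3) => Φ (R⁻¹ • x)) x‖ * ‖g x‖
      ≤ a₀ * ‖iteratedFDeriv ℝ 1 g x‖ + a₁ / R * ‖g x‖ := by
        gcongr

/-- **Second-order Leibniz bound for a scaled profile.**  If `Φ : ℝ³ → (ℝ³ →L G)` is `C²` with `‖Φ‖ ≤ a₀`,
`‖DΦ‖ ≤ a₁`, `‖D²Φ‖ ≤ a₂`, and `g` is `C²`, then for `R > 0`: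
`‖D²(Φ(·/R)[g])(x)‖ ≤ a₀ ‖D²g(x)‖ + (2a₁/R) ‖Dg(x)‖ + (a₂/R²) ‖g(x)‖`. [folklore] -/
theorem norm_iteratedFDeriv_scaledProfile_apply_le_two
    {Φ : EuclideanSpace ℝ (Fin 3) → (EuclideanSpace ℝ (Fin 3) →L[ℝ] G)} (hΦ : ContDiff ℝ 2 Φ) {a₀ a₁ a₂ : ℝ}
    (h0 : ∀ y, ‖Φ y‖ ≤ a₀) (h1 : ∀ y, ‖iteratedFDeriv ℝ 1 Φ y‖ ≤ a₁) (h2 : ∀ y, ‖iteratedFDeriv ℝ 2 Φ y‖ ≤ a₂)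
    {g : EuclideanSpace ℝ (Fin 3) → EuclideanSpace ℝ (Fin 3)} (hg : ContDiff ℝ 2 g) {R : ℝ} (hR : 0 < R)
    (x : EuclideanSpace ℝ (Fin 3)) :
    ‖iteratedFDeriv ℝ 2 (fun x => Φ (R⁻¹ • x) (g x)) x‖ ≤
      a₀ * ‖iteratedFDeriv ℝ 2 g x‖ + 2 * (a₁ / R) * ‖iteratedFDeriv ℝ 1 g x‖ + a₂ / R ^ 2 * ‖g x‖ := by
  have hΦR : ContDiff ℝ 2 (fun x : EuclideanSpace ℝ (Fin 3) => Φ (R⁻¹ • x)) := hΦ.comp (contDiff_const_smul _)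
  have h := norm_iteratedFDeriv_clm_apply (n := 2) hΦR hg x (by norm_num)
  have h' : ‖iteratedFDeriv ℝ 2 (fun x => Φ (R⁻¹ • x) (g x)) x‖ ≤
      ‖iteratedFDeriv ℝ 0 (fun x : EuclideanSpace ℝ (Fin 3) => Φ (R⁻¹ • x)) x‖ * ‖iteratedFDeriv ℝ 2 g x‖ +
        2 * ‖iteratedFDeriv ℝ 1 (fun x : EuclideanSpace ℝ (Fin 3) => Φ (R⁻¹ • x)) x‖ * ‖iteratedFDeriv ℝ 1 g x‖ +
        ‖iteratedFDeriv ℝ 2 (fun x : EuclideanSpace ℝ (Fin 3) => Φ (R⁻¹ • x)) x‖ * ‖iteratedFDeriv ℝ 0 g x‖ := by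
    simp only [Finset.sum_range_succ, Finset.sum_range_zero, zero_add, Nat.choose_zero_right, Nat.cast_one,
      one_mul, Nat.choose_self, Nat.sub_zero, show Nat.choose 2 1 = 2 by rfl, Nat.cast_ofNat] at h
    exact h
  refine h'.trans ?_
  rw [norm_iteratedFDeriv_zero, norm_iteratedFDeriv_zero]
  have e0 : ‖Φ (R⁻¹ • x)‖ ≤ a₀ := h0 _
  have e1 : ‖iteratedFDeriv ℝ 1 (fun x : EuclideanSpace ℝ (Fin 3) => Φ (R⁻¹ • x)) x‖ ≤ a₁ / R := by
    refine (norm_iteratedFDeriv_comp_smul_le hΦ hR (by norm_num) x).trans ?_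
    rw [pow_one, div_eq_inv_mul]
    gcongr
    exact h1 _
  have e2 : ‖iteratedFDeriv ℝ 2 (fun x : EuclideanSpace ℝ (Fin 3) => Φ (R⁻¹ • x)) x‖ ≤ a₂ / R ^ 2 := by
    refine (norm_iteratedFDeriv_comp_smul_le hΦ hR le_rfl x).trans ?_
    rw [inv_pow, div_eq_inv_mul]
    gcongr
    exact h2 _
  have ha₀ : 0 ≤ a₀ := (norm_nonneg _).trans (h0 0)
  have ha₁ : 0 ≤ a₁ / R := le_trans (norm_nonneg _) e1
  calc ‖Φ (R⁻¹ • x)‖ * ‖iteratedFDeriv ℝ 2 g x‖ +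
        2 * ‖iteratedFDeriv ℝ 1 (fun x : EuclideanSpace ℝ (Fin 3) => Φ (R⁻¹ • x)) x‖ * ‖iteratedFDeriv ℝ 1 g x‖ +
        ‖iteratedFDeriv ℝ 2 (fun x : EuclideanSpace ℝ (Fin 3) => Φ (R⁻¹ • x)) x‖ * ‖g x‖
      ≤ a₀ * ‖iteratedFDeriv ℝ 2 g x‖ + 2 * (a₁ / R) * ‖iteratedFDeriv ℝ 1 g x‖ + a₂ / R ^ 2 * ‖g x‖ := by
        gcongr

/-- A smooth compactly supported profile has bounded derivatives of orders `0, 1, 2`. [folklore] -/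
theorem exists_bounds_of_hasCompactSupport {H : Type*} [NormedAddCommGroup H] [NormedSpace ℝ H]
    {Φ : EuclideanSpace ℝ (Fin 3) → H} (hΦ : ContDiff ℝ 2 Φ) (hc : HasCompactSupport Φ) :
    ∃ a : ℝ, 0 ≤ a ∧ (∀ y, ‖Φ y‖ ≤ a) ∧ (∀ y, ‖iteratedFDeriv ℝ 1 Φ y‖ ≤ a) ∧ (∀ y, ‖iteratedFDeriv ℝ 2 Φ y‖ ≤ a) := by
  have hb : ∀ i : ℕ, i ≤ 2 → ∃ a : ℝ, ∀ y, ‖iteratedFDeriv ℝ i Φ y‖ ≤ a := by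
    intro i hi
    have hcont : Continuous (fun y => iteratedFDeriv ℝ i Φ y) :=
      hΦ.continuous_iteratedFDeriv (by exact_mod_cast hi)
    obtain ⟨a, ha⟩ := hcont.bounded_above_of_compact_support (hc.iteratedFDeriv i)
    exact ⟨a, ha⟩
  obtain ⟨b₀, hb₀⟩ := hb 0 (by norm_num)
  obtain ⟨b₁, hb₁⟩ := hb 1 (by norm_num)
  obtain ⟨b₂, hb₂⟩ := hb 2 le_rfl
  refine ⟨max (max b₀ b₁) (max b₂ 0), le_trans (le_max_right _ _) (le_max_right _ _), fun y => ?_, fun y => ?_,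
    fun y => ?_⟩
  · have := hb₀ y
    rw [norm_iteratedFDeriv_zero] at this
    exact this.trans ((le_max_left _ _).trans (le_max_left _ _))
  · exact (hb₁ y).trans ((le_max_right _ _).trans (le_max_left _ _))
  · exact (hb₂ y).trans ((le_max_left _ _).trans (le_max_right _ _))

end Profile

/-! ## The profile representation of the solenoidal truncation -/

section Representation

variable {V : EuclideanSpace ℝ (Fin 3) → EuclideanSpace ℝ (Fin 3)} {R : ℝ}

/-- **`Ψ_R(x) = χ(x/R) V(x) + Φ(x/R)[F(x)]`** with `χ = dyadicCutoff`, `Φ(y) = (Dχ(y)y)·id − Dχ(y) ⊗ y` and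
`F = poincareField V` (unfold `solenoidalTruncation`, `cutoff R = χ(·/R)`, `D(cutoff R)(x) = R⁻¹ Dχ(x/R)`). [folklore] -/
theorem solenoidalTruncation_eq_profile (V : EuclideanSpace ℝ (Fin 3) → EuclideanSpace ℝ (Fin 3)) (R : ℝ) :
    solenoidalTruncation V R = fun x =>
      (FunctionSpaces.dyadicCutoff (EuclideanSpace ℝ (Fin 3)) : EuclideanSpace ℝ (Fin 3) → ℝ) (R⁻¹ • x) • V x +
        ((fderiv ℝ (FunctionSpaces.dyadicCutoff (EuclideanSpace ℝ (Fin 3)) : EuclideanSpace ℝ (Fin 3) → ℝ) (R⁻¹ • x)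
              (R⁻¹ • x)) • ContinuousLinearMap.id ℝ (EuclideanSpace ℝ (Fin 3)) -
          (fderiv ℝ (FunctionSpaces.dyadicCutoff (EuclideanSpace ℝ (Fin 3)) : EuclideanSpace ℝ (Fin 3) → ℝ)
              (R⁻¹ • x)).smulRight (R⁻¹ • x))
          (poincareField V x) := by
  funext x
  set χ : EuclideanSpace ℝ (Fin 3) → ℝ := ⇑(FunctionSpaces.dyadicCutoff (EuclideanSpace ℝ (Fin 3))) with hχ
  have hD : fderiv ℝ (cutoff (E := EuclideanSpace ℝ (Fin 3)) R) x = R⁻¹ • fderiv ℝ χ (R⁻¹ • x) :=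
    fderiv_comp_smul (𝕜 := ℝ) (f := χ) (x := x) R⁻¹
  have hχR : cutoff (E := EuclideanSpace ℝ (Fin 3)) R x = χ (R⁻¹ • x) := rfl
  rw [solenoidalTruncation, hχR, hD]
  simp only [smul_apply, smul_eq_mul, sub_apply, ContinuousLinearMap.smulRight_apply,
    ContinuousLinearMap.id_apply, map_smul]
  module

end Representation

end ExtremiserLiouville

end Summit.NavierStokesRegularity.NavierStokesRegularity.Theorems

end
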